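import Summits.CriticalPhenomena.PercolationContinuityZ3.Theorems.Transplant.FKConnectivityAllQWheelWord
import Summits.CriticalPhenomena.PercolationContinuityZ3.Theorems.Transplant.FKConnectivityAllQRigidInterpolation
import HarnessLib

/-!
# Connectivity correlation inequalities for `φ_{w,q}`, every `q > 0` — APEX-OVER-CYCLE GRAPHS: the wheel pairs of a weight vector, the transfer
# expression `T(w) = q·[Tr seg − (2−q)·∏ r_j·∏ (1−p_j)]`, and its AFFINITY in every wheel pair

Support file (`--supports stmt-CriticalPhenomena-4575`), FK sub-lane `prim-bschramm-fk-3` (gen 8) of the post-continuity programme; builds on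
p205010 (kernel theorem, internal audit signed; external expert review pending).  No named facts, no sorries; standard axioms.
Blueprint: bschramm/prim-bschramm-fk-3/WHEELS-HUB-NC.md §2 (LEMMA T), §6.

A hub `x : V` and rim vertices `v 0, …, v (n−1)` (indices read modulo `n`): `spokePair j = s(x, v j)`, `rimPair j = s(v j, v (j+1))`; a weight vector
`w` has spoke parameters `pOf w j` and rim parameters `rOf w j`; `wheelPairs` is the finset of the `2n` pairs; and
`transferT q w = q·(Tr (seg q (pOf w) (rOf w) n 0 n) − (2−q)·∏_{j<n} rOf w j·∏_{j<n} (1 − pOf w j))` is the right-hand side of LEMMA T.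
Proved here: periodicity and distinctness of the pairs (`3 ≤ n`, rim vertices distinct and `≠ x`), the effect of pinning one pair on the letters
(`letter_update_spoke`, `letter_update_rim`, `seg_congr`), and **`transferT_affine`**: for every wheel pair `e`,
`T(w) = (1 − w e)·T(w[e↦0]) + (w e)·T(w[e↦1])` — the hypothesis of `FK.eq_of_affine_of_rigid` (`…AllQRigidInterpolation.lean`).
[cite: Grimmett2006, §1.4 eq. (1.20) (p. 15); Thm. (3.1)(a) (p. 37)]
-/

noncomputable section

namespace Summit.CriticalPhenomena.PercolationContinuityZ3.Theorems

namespace FK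

namespace Wheel

open Matrix WheelTM Literature.Probability.LatticeModels Literature.Probability.Percolation
open scoped Classical

variable {V : Type*}

/-- The spoke pair of rim vertex `j` (index mod `n`). (transcription of bschramm/prim-bschramm-fk-3/WHEELS-HUB-NC.md §2) -/
def spokePair (x : V) (v : ℕ → V) (n j : ℕ) : Sym2 V := s(x, v (j % n))

/-- The outgoing rim pair of rim vertex `j`: `s(v j, v (j+1))` (indices mod `n`). (transcription of bschramm/prim-bschramm-fk-3/WHEELS-HUB-NC.md §2) -/
def rimPair (v : ℕ → V) (n j : ℕ) : Sym2 V := s(v (j % n), v ((j + 1) % n))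

/-- The spoke parameters of a weight vector. (transcription of bschramm/prim-bschramm-fk-3/WHEELS-HUB-NC.md §2) -/
def pOf (w : Sym2 V → unitInterval) (x : V) (v : ℕ → V) (n j : ℕ) : ℝ := ((w (spokePair x v n j) : unitInterval) : ℝ)

/-- The rim parameters of a weight vector. (transcription of bschramm/prim-bschramm-fk-3/WHEELS-HUB-NC.md §2) -/
def rOf (w : Sym2 V → unitInterval) (v : ℕ → V) (n j : ℕ) : ℝ := ((w (rimPair v n j) : unitInterval) : ℝ)

/-- The `2n` pairs of the wheel. (transcription of bschramm/prim-bschramm-fk-3/WHEELS-HUB-NC.md §2) -/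
def wheelPairs (x : V) (v : ℕ → V) (n : ℕ) : Finset (Sym2 V) :=
  (Finset.range n).image (spokePair x v n) ∪ (Finset.range n).image (rimPair v n)

/-- The transfer expression `T(w) = q·(Tr seg 0 n − (2−q)·∏ r_j ∏ (1 − p_j))` — the right-hand side of LEMMA T.
(transcription of bschramm/prim-bschramm-fk-3/WHEELS-HUB-NC.md §2) -/
def transferT (q : ℝ) (w : Sym2 V → unitInterval) (x : V) (v : ℕ → V) (n : ℕ) : ℝ :=
  q * ((seg q (pOf w x v n) (rOf w v n) n 0 n).trace -
    (2 - q) * (∏ j ∈ Finset.range n, rOf w v n j) * ∏ j ∈ Finset.range n, (1 - pOf w x v n j))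

variable (x : V) (v : ℕ → V) (n : ℕ)

/-! ### Periodicity and distinctness -/

/-- Spoke pairs only depend on the index mod `n`. [folklore] -/
theorem spokePair_mod (j : ℕ) : spokePair x v n (j % n) = spokePair x v n j := by
  unfold spokePair; rw [Nat.mod_mod]

/-- Rim pairs only depend on the index mod `n`. [folklore] -/
theorem rimPair_mod (j : ℕ) : rimPair v n (j % n) = rimPair v n j := by
  unfold rimPair
  rw [Nat.mod_mod]
  rcases Nat.eq_zero_or_pos n with rfl | hn
  · simp
  · rw [Nat.add_mod (j % n) 1 n, Nat.mod_mod, ← Nat.add_mod]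

section Distinct

variable {x v n}
variable (hn : 3 ≤ n) (hinj : ∀ j k, j < n → k < n → v j = v k → j = k) (hx : ∀ j, j < n → v j ≠ x)
include hn hinj hx

omit hinj in
/-- A spoke pair is not a rim pair (the hub is on no rim pair). [folklore] -/
theorem spokePair_ne_rimPair (j k : ℕ) : spokePair x v n j ≠ rimPair v n k := by
  intro h
  unfold spokePair rimPair at h
  have hxmem : x ∈ s(v (k % n), v ((k + 1) % n)) := by rw [← h]; exact Sym2.mem_mk_left _ _
  rw [Sym2.mem_iff] at hxmem
  rcases hxmem with h1 | h1
  · exact hx _ (Nat.mod_lt _ (by omega)) h1.symm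
  · exact hx _ (Nat.mod_lt _ (by omega)) h1.symm

omit hn hx in
/-- Spoke pairs of distinct residues are distinct. [folklore] -/
theorem spokePair_eq_iff {j k : ℕ} (hj : j < n) (hk : k < n) : spokePair x v n j = spokePair x v n k ↔ j = k := by
  constructor
  · intro h
    unfold spokePair at h
    rw [Nat.mod_eq_of_lt hj, Nat.mod_eq_of_lt hk] at h
    have hv : v j = v k := by
      have := Sym2.congr_right (a := x) (b := v j) (c := v k)
      exact this.1 h
    exact hinj _ _ hj hk hv
  · rintro rfl; rfl

omit hx in
/-- Rim pairs of distinct residues are distinct (`n ≥ 3`). [folklore] -/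
theorem rimPair_eq_iff {j k : ℕ} (hj : j < n) (hk : k < n) : rimPair v n j = rimPair v n k ↔ j = k := by
  constructor
  · intro h
    unfold rimPair at h
    rw [Nat.mod_eq_of_lt hj, Nat.mod_eq_of_lt hk, Sym2.eq_iff] at h
    have hj1 : (j + 1) % n < n := Nat.mod_lt _ (by omega)
    have hk1 : (k + 1) % n < n := Nat.mod_lt _ (by omega)
    rcases h with ⟨h1, -⟩ | ⟨h1, h2⟩
    · exact hinj _ _ hj hk h1
    · -- `v j = v (k+1)` and `v (j+1) = v k`: then `j ≡ k+1`, `k ≡ j+1`, impossible mod `n ≥ 3`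
      have e1 := hinj _ _ hj hk1 h1
      have e2 := hinj _ _ hj1 hk h2
      exfalso
      -- `j = (k+1) % n` and `(j+1) % n = k`
      by_cases hk2 : k + 1 < n
      · rw [Nat.mod_eq_of_lt hk2] at e1
        subst e1
        by_cases hk3 : k + 1 + 1 < n
        · rw [Nat.mod_eq_of_lt hk3] at e2; omega
        · have : k + 1 + 1 = n := by omega
          rw [this, Nat.mod_self] at e2; omega
      · have hkn : k + 1 = n := by omega
        rw [hkn, Nat.mod_self] at e1
        subst e1
        rw [Nat.zero_add, Nat.mod_eq_of_lt (by omega : 1 < n)] at e2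
        omega
  · rintro rfl; rfl

omit hn hinj hx in
/-- Membership in `wheelPairs`. [folklore] -/
theorem mem_wheelPairs_iff (e : Sym2 V) :
    e ∈ wheelPairs x v n ↔ (∃ j, j < n ∧ e = spokePair x v n j) ∨ (∃ j, j < n ∧ e = rimPair v n j) := by
  unfold wheelPairs
  simp only [Finset.mem_union, Finset.mem_image, Finset.mem_range]
  constructor
  · rintro (⟨j, hj, rfl⟩ | ⟨j, hj, rfl⟩)
    · exact Or.inl ⟨j, hj, rfl⟩
    · exact Or.inr ⟨j, hj, rfl⟩
  · rintro (⟨j, hj, rfl⟩ | ⟨j, hj, rfl⟩)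
    · exact Or.inl ⟨j, hj, rfl⟩
    · exact Or.inr ⟨j, hj, rfl⟩

end Distinct

/-! ### Pinning one pair: the letters -/

/-- Segments depend only on the letters they use. [folklore] -/
theorem seg_congr (q : ℝ) {p p' r r' : ℕ → ℝ} (a ℓ : ℕ)
    (h : ∀ j, a ≤ j → j < a + ℓ → letter q p' r' n j = letter q p r n j) : seg q p' r' n a ℓ = seg q p r n a ℓ := by
  induction ℓ with
  | zero => rfl
  | succ ℓ ih =>
    rw [seg_succ, seg_succ, ih fun j hj hj' => h j hj (by omega), h (a + ℓ) (by omega) (by omega)]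

/-- The word splits around the letter of vertex `j₀ < n`: `seg 0 n = seg (j₀+1) (n−1−j₀) · letter j₀ · seg 0 j₀`. [folklore] -/
theorem seg_split (q : ℝ) (p r : ℕ → ℝ) {j₀ : ℕ} (hj₀ : j₀ < n) :
    seg q p r n 0 n = seg q p r n (j₀ + 1) (n - 1 - j₀) * letter q p r n j₀ * seg q p r n 0 j₀ := by
  have h1 : seg q p r n 0 n = seg q p r n j₀ (n - j₀) * seg q p r n 0 j₀ := by
    have := seg_add q p r n 0 j₀ (n - j₀)
    rw [Nat.zero_add, show j₀ + (n - j₀) = n by omega] at this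
    exact this
  have h2 : seg q p r n j₀ (n - j₀) = seg q p r n (j₀ + 1) (n - 1 - j₀) * letter q p r n j₀ := by
    have := seg_add q p r n j₀ 1 (n - 1 - j₀)
    rw [show 1 + (n - 1 - j₀) = n - j₀ by omega] at this
    rw [this]
    simp only [seg_succ, seg_zero, Matrix.mul_one, Nat.add_zero]
  rw [h1, h2]

section Update

variable {x v n}
variable (hn : 3 ≤ n) (hinj : ∀ j k, j < n → k < n → v j = v k → j = k) (hx : ∀ j, j < n → v j ≠ x)
include hn hinj hx

omit hx in
/-- Pinning the spoke pair `j₀`: the spoke parameters change at residue `j₀` only. [folklore] -/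
theorem pOf_update_spoke (w : Sym2 V → unitInterval) {j₀ : ℕ} (hj₀ : j₀ < n) (c : unitInterval) (j : ℕ) :
    pOf (Function.update w (spokePair x v n j₀) c) x v n j = if j % n = j₀ then (c : ℝ) else pOf w x v n j := by
  unfold pOf
  by_cases h : j % n = j₀
  · rw [if_pos h, ← spokePair_mod x v n j, h, Function.update_self]
  · rw [if_neg h, Function.update_of_ne]
    exact fun he => h ((spokePair_eq_iff hinj (Nat.mod_lt _ (by omega)) hj₀).1 ((spokePair_mod x v n j).trans he))

omit hinj in
/-- Pinning a spoke pair does not change the rim parameters. [folklore] -/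
theorem rOf_update_spoke (w : Sym2 V → unitInterval) (j₀ : ℕ) (c : unitInterval) (j : ℕ) :
    rOf (Function.update w (spokePair x v n j₀) c) v n j = rOf w v n j := by
  unfold rOf
  rw [Function.update_of_ne (fun h => spokePair_ne_rimPair hn hx j₀ j h.symm)]

omit hx in
/-- Pinning the rim pair `j₀`: the rim parameters change at residue `j₀` only. [folklore] -/
theorem rOf_update_rim (w : Sym2 V → unitInterval) {j₀ : ℕ} (hj₀ : j₀ < n) (c : unitInterval) (j : ℕ) :
    rOf (Function.update w (rimPair v n j₀) c) v n j = if j % n = j₀ then (c : ℝ) else rOf w v n j := by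
  unfold rOf
  by_cases h : j % n = j₀
  · rw [if_pos h, ← rimPair_mod v n j, h, Function.update_self]
  · rw [if_neg h, Function.update_of_ne]
    exact fun he => h ((rimPair_eq_iff hn hinj (Nat.mod_lt _ (by omega)) hj₀).1 ((rimPair_mod v n j).trans he))

omit hinj in
/-- Pinning a rim pair does not change the spoke parameters. [folklore] -/
theorem pOf_update_rim (w : Sym2 V → unitInterval) (j₀ : ℕ) (c : unitInterval) (j : ℕ) :
    pOf (Function.update w (rimPair v n j₀) c) x v n j = pOf w x v n j := by
  unfold pOf
  rw [Function.update_of_ne (fun h => spokePair_ne_rimPair hn hx j j₀ h)]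

/-- **Letters after pinning the spoke pair `j₀ < n`**: the letter of residue `j₀` becomes `E(r_{j₀})·S(c)`, the others are unchanged. [folklore] -/
theorem letter_update_spoke (q : ℝ) (w : Sym2 V → unitInterval) {j₀ : ℕ} (hj₀ : j₀ < n) (c : unitInterval) (j : ℕ) :
    letter q (pOf (Function.update w (spokePair x v n j₀) c) x v n) (rOf (Function.update w (spokePair x v n j₀) c) v n) n j =
      if j % n = j₀ then edgeM q (rOf w v n j₀) * spokeM (c : ℝ) else letter q (pOf w x v n) (rOf w v n) n j := by
  unfold letter
  rw [pOf_update_spoke hn hinj w hj₀ c, rOf_update_spoke hn hx w j₀ c, Nat.mod_mod]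
  by_cases h : j % n = j₀
  · rw [if_pos h, if_pos h, h]
  · rw [if_neg h, if_neg h]

/-- **Letters after pinning the rim pair `j₀ < n`**: the letter of residue `j₀` becomes `E(c)·S(p_{j₀})`, the others are unchanged. [folklore] -/
theorem letter_update_rim (q : ℝ) (w : Sym2 V → unitInterval) {j₀ : ℕ} (hj₀ : j₀ < n) (c : unitInterval) (j : ℕ) :
    letter q (pOf (Function.update w (rimPair v n j₀) c) x v n) (rOf (Function.update w (rimPair v n j₀) c) v n) n j =
      if j % n = j₀ then edgeM q (c : ℝ) * spokeM (pOf w x v n j₀) else letter q (pOf w x v n) (rOf w v n) n j := by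
  unfold letter
  rw [rOf_update_rim hn hinj w hj₀ c, pOf_update_rim hn hx w j₀ c, Nat.mod_mod]
  by_cases h : j % n = j₀
  · rw [if_pos h, if_pos h, h]
  · rw [if_neg h, if_neg h]

/-- **The transfer expression after pinning a spoke pair is affine in the pinned value**: `T(w[e↦c]) = T(w[e↦0]) + c·(T(w[e↦1]) − T(w[e↦0]))`.
[cite: Grimmett2006, Thm. (3.1)(a) (p. 37)] -/
theorem transferT_update_spoke (q : ℝ) (w : Sym2 V → unitInterval) {j₀ : ℕ} (hj₀ : j₀ < n) (c : unitInterval) :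
    transferT q (Function.update w (spokePair x v n j₀) c) x v n =
      (1 - (c : ℝ)) * transferT q (Function.update w (spokePair x v n j₀) 0) x v n +
        (c : ℝ) * transferT q (Function.update w (spokePair x v n j₀) 1) x v n := by
  -- the outer segments do not see the pinned letter
  set p := pOf w x v n
  set r := rOf w v n
  set A := seg q p r n (j₀ + 1) (n - 1 - j₀) with hA
  set B := seg q p r n 0 j₀ with hB
  have hw : ∀ d : unitInterval, seg q (pOf (Function.update w (spokePair x v n j₀) d) x v n)
      (rOf (Function.update w (spokePair x v n j₀) d) v n) n 0 n = A * (edgeM q (r j₀) * spokeM (d : ℝ)) * B := by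
    intro d
    rw [seg_split n q _ _ hj₀]
    have hL := letter_update_spoke hn hinj hx q w hj₀ d
    rw [hL j₀, if_pos (Nat.mod_eq_of_lt hj₀)]
    congr 1
    · congr 1
      exact seg_congr n q _ _ fun j hj hj' => by
        rw [hL j, if_neg]
        intro h
        have : j % n = j := Nat.mod_eq_of_lt (by omega)
        omega
    · exact seg_congr n q _ _ fun j hj hj' => by
        rw [hL j, if_neg]
        intro h
        have : j % n = j := Nat.mod_eq_of_lt (by omega)
        omega
  -- the products
  have hR : ∀ d : unitInterval, ∏ j ∈ Finset.range n, rOf (Function.update w (spokePair x v n j₀) d) v n j = ∏ j ∈ Finset.range n, r j :=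
    fun d => Finset.prod_congr rfl fun j _ => rOf_update_spoke hn hx w j₀ d j
  have hP : ∀ d : unitInterval, ∏ j ∈ Finset.range n, (1 - pOf (Function.update w (spokePair x v n j₀) d) x v n j) =
      (1 - (d : ℝ)) * ∏ j ∈ (Finset.range n).erase j₀, (1 - p j) := by
    intro d
    rw [← Finset.mul_prod_erase _ _ (Finset.mem_range.2 hj₀), pOf_update_spoke hn hinj w hj₀ d j₀, if_pos (Nat.mod_eq_of_lt hj₀)]
    congr 1
    refine Finset.prod_congr rfl fun j hj => ?_
    rw [Finset.mem_erase, Finset.mem_range] at hj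
    rw [pOf_update_spoke hn hinj w hj₀ d j, if_neg (by rw [Nat.mod_eq_of_lt hj.2]; exact hj.1)]
  -- the spoke matrix is affine: `S(c) = (1−c)•S(0) + c•S(1)`
  have hS : spokeM ((c : unitInterval) : ℝ) = (1 - (c : ℝ)) • spokeM ((0 : unitInterval) : ℝ) + (c : ℝ) • spokeM ((1 : unitInterval) : ℝ) := by
    ext a b; fin_cases a <;> fin_cases b <;> simp [spokeM]
  unfold transferT
  rw [hw c, hw 0, hw 1, hR c, hR 0, hR 1, hP c, hP 0, hP 1, hS]
  simp only [Matrix.mul_add, Matrix.add_mul, Matrix.mul_smul, Matrix.smul_mul, Matrix.trace_add, Matrix.trace_smul, smul_eq_mul]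
  push_cast
  ring

/-- **The transfer expression after pinning a rim pair is affine in the pinned value.** [cite: Grimmett2006, Thm. (3.1)(a) (p. 37)] -/
theorem transferT_update_rim (q : ℝ) (w : Sym2 V → unitInterval) {j₀ : ℕ} (hj₀ : j₀ < n) (c : unitInterval) :
    transferT q (Function.update w (rimPair v n j₀) c) x v n =
      (1 - (c : ℝ)) * transferT q (Function.update w (rimPair v n j₀) 0) x v n +
        (c : ℝ) * transferT q (Function.update w (rimPair v n j₀) 1) x v n := by
  set p := pOf w x v n
  set r := rOf w v n
  set A := seg q p r n (j₀ + 1) (n - 1 - j₀) with hA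
  set B := seg q p r n 0 j₀ with hB
  have hw : ∀ d : unitInterval, seg q (pOf (Function.update w (rimPair v n j₀) d) x v n)
      (rOf (Function.update w (rimPair v n j₀) d) v n) n 0 n = A * (edgeM q (d : ℝ) * spokeM (p j₀)) * B := by
    intro d
    rw [seg_split n q _ _ hj₀]
    have hL := letter_update_rim hn hinj hx q w hj₀ d
    rw [hL j₀, if_pos (Nat.mod_eq_of_lt hj₀)]
    congr 1
    · congr 1
      exact seg_congr n q _ _ fun j hj hj' => by
        rw [hL j, if_neg]
        intro h
        have : j % n = j := Nat.mod_eq_of_lt (by omega)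
        omega
    · exact seg_congr n q _ _ fun j hj hj' => by
        rw [hL j, if_neg]
        intro h
        have : j % n = j := Nat.mod_eq_of_lt (by omega)
        omega
  have hP : ∀ d : unitInterval, ∏ j ∈ Finset.range n, (1 - pOf (Function.update w (rimPair v n j₀) d) x v n j) =
      ∏ j ∈ Finset.range n, (1 - p j) :=
    fun d => Finset.prod_congr rfl fun j _ => by rw [pOf_update_rim hn hx w j₀ d j]
  have hR : ∀ d : unitInterval, ∏ j ∈ Finset.range n, rOf (Function.update w (rimPair v n j₀) d) v n j =
      (d : ℝ) * ∏ j ∈ (Finset.range n).erase j₀, r j := by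
    intro d
    rw [← Finset.mul_prod_erase _ _ (Finset.mem_range.2 hj₀), rOf_update_rim hn hinj w hj₀ d j₀, if_pos (Nat.mod_eq_of_lt hj₀)]
    congr 1
    refine Finset.prod_congr rfl fun j hj => ?_
    rw [Finset.mem_erase, Finset.mem_range] at hj
    rw [rOf_update_rim hn hinj w hj₀ d j, if_neg (by rw [Nat.mod_eq_of_lt hj.2]; exact hj.1)]
  have hE : edgeM q ((c : unitInterval) : ℝ) = (1 - (c : ℝ)) • edgeM q ((0 : unitInterval) : ℝ) + (c : ℝ) • edgeM q ((1 : unitInterval) : ℝ) := by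
    ext a b; fin_cases a <;> fin_cases b <;> simp [edgeM]; ring
  unfold transferT
  rw [hw c, hw 0, hw 1, hR c, hR 0, hR 1, hP c, hP 0, hP 1, hE]
  simp only [Matrix.mul_add, Matrix.add_mul, Matrix.mul_smul, Matrix.smul_mul, Matrix.trace_add, Matrix.trace_smul, smul_eq_mul]
  push_cast
  ring

/-- **Affinity of the transfer expression in every wheel pair**: `T(w) = (1 − w e)·T(w[e↦0]) + (w e)·T(w[e↦1])` for `e ∈ wheelPairs`.
[cite: Grimmett2006, Thm. (3.1)(a) (p. 37)] -/
theorem transferT_affine (q : ℝ) (w : Sym2 V → unitInterval) {e : Sym2 V} (he : e ∈ wheelPairs x v n) :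
    transferT q w x v n = (1 - ((w e : unitInterval) : ℝ)) * transferT q (Function.update w e 0) x v n +
      ((w e : unitInterval) : ℝ) * transferT q (Function.update w e 1) x v n := by
  rcases (mem_wheelPairs_iff e).1 he with ⟨j₀, hj₀, rfl⟩ | ⟨j₀, hj₀, rfl⟩
  · have h := transferT_update_spoke hn hinj hx q w hj₀ (w (spokePair x v n j₀))
    rwa [Function.update_eq_self] at h
  · have h := transferT_update_rim hn hinj hx q w hj₀ (w (rimPair v n j₀))
    rwa [Function.update_eq_self] at h

end Update

end Wheel

end FK

end Summit.CriticalPhenomena.PercolationContinuityZ3.Theorems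

end
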